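import Summits.CriticalPhenomena.PercolationContinuityZ3.Theorems.PercNearOneGluingNoHeavyLowerTailSunflowerPowerCertificate

/-!
# (RES0′) for every `n` from a BOXED-EXEMPTION (hybrid) certificate

(prove-1 gen 58, memo run/shared/lean/prim/prim-ineq-prove-1/FINDING-BOXED-prove1-g58.md §1–§3.)  Model of g52 §0 (see
`…SunflowerVertexFibresA`): petals `(y,k,g,h)` of the polytope `α₀₀ ≤ y ≤ k ≤ 1`, `α₀₁ ≤ g ≤ min(k,h)`, `α₁₁ ≤ h ≤ 1`, value
`G`, the six budgets `∏y ≤ α₀₀^(n−1)`, `∏k ≤ α₀₁^(n−1)`, `∏g ≤ α₀₁^(n−1)`, `∏h ≤ α₁₁^(n−1)`, `∏Ȳ ≤ b_Ȳ^(n−1)`, `∏H ≤ b_H^(n−1)`.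
The power-certificate criterion of g55/g57 (`res0_of_vertex_certificate`) has a genuine LP gap at ≈ 2 % of parameter points
(the fractional relaxation uses a FRACTION of a big petal).  The repair is to keep a bounded set `E` of EXEMPT petals exact:

* `card_filter_gt_le` — the knapsack count: under `∏k ≤ α₀₁^(n−1)`, `k_j ≥ α₀₁`, at most `L` petals have `k_j > θ` when
  `α₀₁^L ≤ θ^(L+1)` (e.g. `θ = α₀₁^(2/3)`, `L = 2`); so the exempt set `E = {k > θ_k or h > θ_h}` has bounded size and the
  non-exempt ("small") petals live in `{k ≤ θ_k, h ≤ θ_h}`;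
* `res0_of_boxed_certificate` — if ONE exponent vector `λ ≥ 0` satisfies the six-budget power inequality with constant `g` on the
  SMALL region (cut further by the residual caps `k ≤ capK`, `g ≤ capG`, `h ≤ capH` that the exempt petals leave:
  `α₀₁^|E| ≤ capK·∏_E k_i` etc.), and with constants `g·e^(z_j)` at the exempt petals, and the cap row
  `(1/α₀₀)^λ_y ⋯ (1/b_H)^λ_H · e^(Σ_E z_j) ≤ a/g` holds, then `∏ G_j ≤ g^(n−1)·a` — (RES0′) for this family, any `n`.

The two region hypotheses are discharged box by box by `box_one_petal` (`…SunflowerBoxReduction`): a finite LP per "situation"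
(which boxes the exempt petals occupy), refined by branch-and-bound; numerically ALL sampled parameter points are certified this way
(level `L = 2` suffices at 100 % of 10⁵ points; g57's vertex criterion is the case `E = ∅`), memo §3. [this work]
-/

namespace Summit.CriticalPhenomena.PercolationContinuityZ3.Theorems.SunflowerPartition.SafeCalc.LinkedCurrency

open Finset

/-- **Knapsack count.**  If every `f j ≥ fl > 0`, `∏_S f ≤ fl^(|S|−1)` and `fl^L ≤ θ^(L+1)` with `fl ≤ θ`, then at most `L` indices
have `f j > θ` (with `L+1` of them the product would exceed `θ^(L+1)·fl^(|S|−L−1) ≥ fl^(|S|−1)`).  Used with `f = k`, `fl = α₀₁`,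
`θ = α₀₁^(L/(L+1))` (and `f = h`, `fl = α₁₁`): a budget-feasible family has at most `L` exempt petals of each kind. [this work] -/
theorem card_filter_gt_le {κ : Type*} [DecidableEq κ] (S : Finset κ) (f : κ → ℝ) (fl θ : ℝ) (L : ℕ)
    (hfl : 0 < fl) (hflθ : fl ≤ θ) (hθ : fl ^ L ≤ θ ^ (L + 1))
    (hf : ∀ j ∈ S, fl ≤ f j) (hB : ∏ j ∈ S, f j ≤ fl ^ (S.card - 1)) :
    (S.filter (fun j => θ < f j)).card ≤ L := by
  by_contra hL
  rw [not_le] at hL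
  set F := S.filter (fun j => θ < f j) with hF
  have hFS : F ⊆ S := Finset.filter_subset _ _
  have hθ0 : 0 < θ := lt_of_lt_of_le hfl hflθ
  have hcardF : L + 1 ≤ F.card := hL
  have hcardS : F.card ≤ S.card := Finset.card_le_card hFS
  -- ∏_S f = ∏_F f * ∏_{S\F} f ≥ θ^|F| * fl^(|S|-|F|), and > unless F = ∅ (here |F| ≥ 1, strict)
  have hsplit : ∏ j ∈ S, f j = (∏ j ∈ F, f j) * ∏ j ∈ S \ F, f j := by
    rw [← Finset.prod_sdiff hFS, mul_comm]
  have hF1 : ∀ j ∈ F, θ < f j := fun j hj => (Finset.mem_filter.1 hj).2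
  have hprodF : θ ^ F.card < ∏ j ∈ F, f j := by
    have hne : F.Nonempty := Finset.card_pos.1 (by omega)
    calc θ ^ F.card = ∏ _j ∈ F, θ := (Finset.prod_const θ).symm
      _ < ∏ j ∈ F, f j := Finset.prod_lt_prod_of_nonempty (fun j _ => hθ0) (fun j hj => hF1 j hj) hne
  have hprodR : fl ^ (S \ F).card ≤ ∏ j ∈ S \ F, f j := by
    calc fl ^ (S \ F).card = ∏ _j ∈ S \ F, fl := (Finset.prod_const fl).symm
      _ ≤ ∏ j ∈ S \ F, f j := Finset.prod_le_prod (fun j _ => hfl.le) (fun j hj => hf j (Finset.mem_sdiff.1 hj).1)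
  have hcardR : (S \ F).card = S.card - F.card := Finset.card_sdiff_of_subset hFS
  have hRpos : 0 < fl ^ (S \ F).card := pow_pos hfl _
  have hlow : θ ^ F.card * fl ^ (S \ F).card < ∏ j ∈ S, f j := by
    rw [hsplit]
    calc θ ^ F.card * fl ^ (S \ F).card < (∏ j ∈ F, f j) * fl ^ (S \ F).card := mul_lt_mul_of_pos_right hprodF hRpos
      _ ≤ (∏ j ∈ F, f j) * ∏ j ∈ S \ F, f j :=
          mul_le_mul_of_nonneg_left hprodR (le_of_lt (lt_trans (pow_pos hθ0 _) hprodF))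
  -- θ^|F| fl^(|S|-|F|) ≥ θ^(L+1) fl^(|S|-L-1) ≥ fl^L fl^(|S|-L-1) = fl^(|S|-1)
  have hθ1 : θ ^ (L + 1) * fl ^ (S.card - (L + 1)) ≤ θ ^ F.card * fl ^ (S \ F).card := by
    -- move (|F| - (L+1)) factors from fl to θ
    obtain ⟨d, hd⟩ : ∃ d, F.card = L + 1 + d := ⟨F.card - (L + 1), by omega⟩
    have e1 : S.card - (L + 1) = (S \ F).card + d := by rw [hcardR]; omega
    have e2 : θ ^ F.card = θ ^ (L + 1) * θ ^ d := by rw [hd, pow_add]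
    have e3 : fl ^ (S.card - (L + 1)) = fl ^ (S \ F).card * fl ^ d := by rw [e1, pow_add]
    rw [e2, e3]
    have hdd : fl ^ d ≤ θ ^ d := pow_le_pow_left₀ hfl.le hflθ d
    have hA : 0 ≤ θ ^ (L + 1) := pow_nonneg hθ0.le _
    have hBn : 0 ≤ fl ^ (S \ F).card := pow_nonneg hfl.le _
    calc θ ^ (L + 1) * (fl ^ (S \ F).card * fl ^ d)
        = (θ ^ (L + 1) * fl ^ d) * fl ^ (S \ F).card := by ring
      _ ≤ (θ ^ (L + 1) * θ ^ d) * fl ^ (S \ F).card :=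
          mul_le_mul_of_nonneg_right (mul_le_mul_of_nonneg_left hdd hA) hBn
  have hθ2 : fl ^ (S.card - 1) ≤ θ ^ (L + 1) * fl ^ (S.card - (L + 1)) := by
    have e : fl ^ (S.card - 1) = fl ^ L * fl ^ (S.card - (L + 1)) := by rw [← pow_add]; congr 1; omega
    rw [e]
    exact mul_le_mul_of_nonneg_right hθ (pow_nonneg hfl.le _)
  have : fl ^ (S.card - 1) < ∏ j ∈ S, f j := lt_of_le_of_lt (hθ2.trans hθ1) hlow
  linarith

/-- Residual cap: under a cell budget `∏_S f ≤ fl^(|S|−1)` with `f ≥ fl > 0`, a petal `j` outside the exempt set `E` satisfies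
`f j · ∏_E f ≤ fl^|E|`; hence `f j ≤ cap` whenever `fl^|E| ≤ cap · ∏_E f`. [this work] -/
theorem le_cap_of_budget {κ : Type*} [DecidableEq κ] (S E : Finset κ) (hES : E ⊆ S) (f : κ → ℝ) (fl cap : ℝ)
    (hfl : 0 < fl) (hf : ∀ j ∈ S, fl ≤ f j) (hB : ∏ j ∈ S, f j ≤ fl ^ (S.card - 1))
    (hcap : fl ^ E.card ≤ cap * ∏ i ∈ E, f i) :
    ∀ j ∈ S, j ∉ E → f j ≤ cap := by
  intro j hj hjE
  have hfpos : ∀ i ∈ S, 0 < f i := fun i hi => lt_of_lt_of_le hfl (hf i hi)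
  have hEpos : 0 < ∏ i ∈ E, f i := Finset.prod_pos (fun i hi => hfpos i (hES hi))
  -- S = {j} ∪ E ∪ R
  have hEe : E ⊆ S.erase j := fun i hi => Finset.mem_erase.2 ⟨fun h => hjE (h ▸ hi), hES hi⟩
  set R := (S.erase j) \ E with hR
  have hsplit : ∏ i ∈ S, f i = f j * ((∏ i ∈ E, f i) * ∏ i ∈ R, f i) := by
    rw [← Finset.mul_prod_erase S f hj, ← Finset.prod_sdiff hEe, mul_comm (∏ i ∈ (S.erase j) \ E, f i)]
  have hcardR : R.card = S.card - 1 - E.card := by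
    rw [hR, Finset.card_sdiff_of_subset hEe, Finset.card_erase_of_mem hj]
  have hRS : ∀ i ∈ R, i ∈ S := fun i hi => (Finset.mem_erase.1 (Finset.mem_sdiff.1 hi).1).2
  have hprodR : fl ^ R.card ≤ ∏ i ∈ R, f i := by
    calc fl ^ R.card = ∏ _i ∈ R, fl := (Finset.prod_const fl).symm
      _ ≤ ∏ i ∈ R, f i := Finset.prod_le_prod (fun i _ => hfl.le) (fun i hi => hf i (hRS i hi))
  have hEcard : E.card ≤ S.card - 1 := by
    have := Finset.card_le_card hEe; rw [Finset.card_erase_of_mem hj] at this; exact this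
  -- f j * ∏_E f * fl^|R| ≤ ∏_S f ≤ fl^(|S|-1) = fl^|E| * fl^|R|
  have h1 : f j * (∏ i ∈ E, f i) * fl ^ R.card ≤ fl ^ E.card * fl ^ R.card := by
    have e : fl ^ (S.card - 1) = fl ^ E.card * fl ^ R.card := by
      rw [← pow_add]; congr 1; omega
    calc f j * (∏ i ∈ E, f i) * fl ^ R.card ≤ f j * (∏ i ∈ E, f i) * ∏ i ∈ R, f i :=
          mul_le_mul_of_nonneg_left hprodR (mul_nonneg (hfpos j hj).le hEpos.le)
      _ = ∏ i ∈ S, f i := by rw [hsplit]; ring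
      _ ≤ fl ^ (S.card - 1) := hB
      _ = fl ^ E.card * fl ^ R.card := e
  have h2 : f j * (∏ i ∈ E, f i) ≤ fl ^ E.card := le_of_mul_le_mul_right h1 (pow_pos hfl _)
  have h3 : f j * (∏ i ∈ E, f i) ≤ cap * ∏ i ∈ E, f i := h2.trans hcap
  exact le_of_mul_le_mul_right h3 hEpos

set_option maxHeartbeats 1600000 in
/-- **(RES0′) for every `n` from a boxed-exemption (hybrid) certificate.**  Parameters as in g57; a nonempty family `S` of petals
obeying the six budgets; an exempt set `E ⊆ S` outside which every petal has `k ≤ θ_k` and `h ≤ θ_h`; residual caps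
`capK, capG, capH` with `α₀₁^|E| ≤ capK·∏_E k`, `α₀₁^|E| ≤ capG·∏_E g`, `α₁₁^|E| ≤ capH·∏_E h`.  If the six-budget power inequality
with exponents `λ ≥ 0` holds with constant `g` on the small region `{k ≤ θ_k, h ≤ θ_h, k ≤ capK, g ≤ capG, h ≤ capH}` of the petal
polytope, with constant `g·e^(z_j)` at each exempt petal `j ∈ E`, and the cap `(1/α₀₀)^λ_y ⋯ (1/b_H)^λ_H · e^(Σ_E z) ≤ a/g` holds,
then `∏_S G_j ≤ g^(n−1)·a`.  (The region hypothesis is discharged box by box with `box_one_petal`; `E = ∅` recovers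
`res0_of_vertex_certificate`.) [this work] -/
theorem res0_of_boxed_certificate {κ : Type*} [DecidableEq κ] {τ σ s α00 α01 α11 c0 g ly lk lg lh lX lH θk θh capK capG capH : ℝ}
    (hP : 0 < τ ∧ τ < 1 ∧ 0 < σ ∧ σ < 1 ∧ 0 < s ∧ s < 1 ∧ 0 < α00 ∧ α00 ≤ α01 ∧ α01 ≤ α11 ∧ α11 ≤ 1 ∧
      τ * σ + (1 - τ) * (1 - s) * α00 ≤ c0 ∧ 0 ≤ ly ∧ 0 ≤ lk ∧ 0 ≤ lg ∧ 0 ≤ lh ∧ 0 ≤ lX ∧ 0 ≤ lH ∧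
      g = (c0 + τ * (1 - σ) * ((1 - s) * α00 + s * α01) + s * (1 - τ) * ((1 - σ) * α01 + σ * α11)))
    (S : Finset κ) (hS : S.Nonempty) (y k gc h : κ → ℝ)
    (hy : ∀ j ∈ S, α00 ≤ y j) (hyk : ∀ j ∈ S, y j ≤ k j) (hk1 : ∀ j ∈ S, k j ≤ 1) (hg1 : ∀ j ∈ S, α01 ≤ gc j)
    (hgk : ∀ j ∈ S, gc j ≤ k j) (hgh : ∀ j ∈ S, gc j ≤ h j) (hh : ∀ j ∈ S, α11 ≤ h j) (hh1 : ∀ j ∈ S, h j ≤ 1)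
    (hBy : ∏ j ∈ S, y j ≤ α00 ^ (S.card - 1)) (hBk : ∏ j ∈ S, k j ≤ α01 ^ (S.card - 1)) (hBg : ∏ j ∈ S, gc j ≤ α01 ^ (S.card - 1))
    (hBh : ∏ j ∈ S, h j ≤ α11 ^ (S.card - 1))
    (hBY : ∏ j ∈ S, ((1 - s) * y j + s * k j) ≤ ((1 - s) * α00 + s * α01) ^ (S.card - 1))
    (hBH : ∏ j ∈ S, ((1 - σ) * gc j + σ * h j) ≤ ((1 - σ) * α01 + σ * α11) ^ (S.card - 1))
    (E : Finset κ) (hES : E ⊆ S) (hEk : ∀ j ∈ S, j ∉ E → k j ≤ θk) (hEh : ∀ j ∈ S, j ∉ E → h j ≤ θh)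
    (hcapK : α01 ^ E.card ≤ capK * ∏ i ∈ E, k i) (hcapG : α01 ^ E.card ≤ capG * ∏ i ∈ E, gc i)
    (hcapH : α11 ^ E.card ≤ capH * ∏ i ∈ E, h i)
    (z : κ → ℝ)
    (hsmall : ∀ y' k' g' h' : ℝ, α00 ≤ y' → y' ≤ k' → k' ≤ 1 → α01 ≤ g' → g' ≤ k' → g' ≤ h' → α11 ≤ h' → h' ≤ 1 →
        k' ≤ θk → h' ≤ θh → k' ≤ capK → g' ≤ capG → h' ≤ capH →
        (c0 + τ * (1 - σ) * ((1 - s) * y' + s * k') + s * (1 - τ) * ((1 - σ) * g' + σ * h')) ≤ g * (y' / α00) ^ ly * (k' / α01) ^ lk * (g' / α01) ^ lg * (h' / α11) ^ lh * (((1 - s) * y' + s * k') / ((1 - s) * α00 + s * α01)) ^ lX * (((1 - σ) * g' + σ * h') / ((1 - σ) * α01 + σ * α11)) ^ lH)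
    (hbig : ∀ j ∈ E, (c0 + τ * (1 - σ) * ((1 - s) * y j + s * k j) + s * (1 - τ) * ((1 - σ) * gc j + σ * h j)) ≤ g * Real.exp (z j) * (y j / α00) ^ ly * (k j / α01) ^ lk * (gc j / α01) ^ lg * (h j / α11) ^ lh * (((1 - s) * y j + s * k j) / ((1 - s) * α00 + s * α01)) ^ lX * (((1 - σ) * gc j + σ * h j) / ((1 - σ) * α01 + σ * α11)) ^ lH)
    (hcap : (1 / α00) ^ ly * (1 / α01) ^ lk * (1 / α01) ^ lg * (1 / α11) ^ lh * (1 / ((1 - s) * α00 + s * α01)) ^ lX * (1 / ((1 - σ) * α01 + σ * α11)) ^ lH * Real.exp (∑ j ∈ E, z j) ≤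
      (c0 + τ * (1 - σ) + s * (1 - τ)) / g) :
    ∏ j ∈ S, (c0 + τ * (1 - σ) * ((1 - s) * y j + s * k j) + s * (1 - τ) * ((1 - σ) * gc j + σ * h j)) ≤
      g ^ (S.card - 1) * (c0 + τ * (1 - σ) + s * (1 - τ)) := by
  obtain ⟨hτ0, hτ1, hσ0, hσ1, hs0, hs1, hα00, h01, h11, hα1, hc0, hly, hlk, hlg, hlh, hlX, hlH, hg⟩ := hP
  have hα01 : 0 < α01 := lt_of_lt_of_le hα00 h01
  have hα11 : 0 < α11 := lt_of_lt_of_le hα01 h11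
  have h1σ : 0 < 1 - σ := sub_pos.2 hσ1
  have h1s : 0 < 1 - s := sub_pos.2 hs1
  have h1τ : 0 < 1 - τ := sub_pos.2 hτ1
  have hp0 : 0 < τ * (1 - σ) := mul_pos hτ0 h1σ
  have hq0 : 0 < s * (1 - τ) := mul_pos hs0 h1τ
  have hc0' : 0 ≤ c0 := le_trans (add_nonneg (mul_nonneg hτ0.le hσ0.le) (mul_nonneg (mul_nonneg h1τ.le h1s.le) hα00.le)) hc0
  obtain ⟨bY, hbY⟩ : ∃ b, b = ((1 - s) * α00 + s * α01) := ⟨_, rfl⟩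
  obtain ⟨bH, hbH⟩ : ∃ b, b = ((1 - σ) * α01 + σ * α11) := ⟨_, rfl⟩
  have hbY0 : 0 < bY := by rw [hbY]; exact add_pos (mul_pos h1s hα00) (mul_pos hs0 hα01)
  have hbH0 : 0 < bH := by rw [hbH]; exact add_pos (mul_pos h1σ hα01) (mul_pos hσ0 hα11)
  rw [← hbY] at hBY hcap hsmall hbig hg; rw [← hbH] at hBH hcap hsmall hbig hg
  have hgpos : 0 < g := by
    rw [hg]; exact add_pos_of_nonneg_of_pos (add_nonneg hc0' (mul_nonneg hp0.le hbY0.le)) (mul_pos hq0 hbH0)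
  -- residual caps for the small petals
  have hKc := le_cap_of_budget S E hES k α01 capK hα01 (fun j hj => (hg1 j hj).trans (hgk j hj)) hBk hcapK
  have hGc := le_cap_of_budget S E hES gc α01 capG hα01 hg1 hBg hcapG
  have hHc := le_cap_of_budget S E hES h α11 capH hα11 hh hBh hcapH
  obtain ⟨n, hn⟩ : ∃ n, n = S.card := ⟨_, rfl⟩
  rw [← hn] at hBy hBk hBg hBh hBY hBH ⊢
  have hcardS : S.card = n := hn.symm
  -- usage vectors, caps, exponents as `Fin`-vectors
  have hu1 : ∀ j ∈ S, ∀ i ∈ (Finset.univ : Finset (Fin 6)),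
      1 ≤ (![y j / α00, k j / α01, gc j / α01, h j / α11, ((1 - s) * y j + s * k j) / bY,
        ((1 - σ) * gc j + σ * h j) / bH] : Fin 6 → ℝ) i := by
    intro j hj i _
    have := hy j hj; have := hyk j hj; have := hg1 j hj; have := hgk j hj; have := hgh j hj; have := hh j hj
    fin_cases i
    · show 1 ≤ y j / α00; rw [le_div_iff₀ hα00]; linarith
    · show 1 ≤ k j / α01; rw [le_div_iff₀ hα01]; linarith
    · show 1 ≤ gc j / α01; rw [le_div_iff₀ hα01]; linarith
    · show 1 ≤ h j / α11; rw [le_div_iff₀ hα11]; linarith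
    · show 1 ≤ ((1 - s) * y j + s * k j) / bY
      rw [le_div_iff₀ hbY0, hbY]; nlinarith [mul_le_mul_of_nonneg_left (hy j hj) h1s.le,
        mul_le_mul_of_nonneg_left (show α01 ≤ k j by linarith) hs0.le]
    · show 1 ≤ ((1 - σ) * gc j + σ * h j) / bH
      rw [le_div_iff₀ hbH0, hbH]; nlinarith [mul_le_mul_of_nonneg_left (hg1 j hj) h1σ.le,
        mul_le_mul_of_nonneg_left (hh j hj) hσ0.le]
  have hupos : ∀ j ∈ S, ∀ i ∈ (Finset.univ : Finset (Fin 6)),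
      0 < (![y j / α00, k j / α01, gc j / α01, h j / α11, ((1 - s) * y j + s * k j) / bY,
        ((1 - σ) * gc j + σ * h j) / bH] : Fin 6 → ℝ) i := fun j hj i hi => lt_of_lt_of_le zero_lt_one (hu1 j hj i hi)
  have hV0 : ∀ j ∈ S, 0 ≤ (c0 + τ * (1 - σ) * ((1 - s) * y j + s * k j) + s * (1 - τ) * ((1 - σ) * gc j + σ * h j)) / g :=
    fun j hj => by
    apply div_nonneg _ hgpos.le
    have hy0 : 0 ≤ y j := hα00.le.trans (hy j hj)
    have hk0 : 0 ≤ k j := hy0.trans (hyk j hj)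
    exact add_nonneg (add_nonneg hc0' (mul_nonneg hp0.le (add_nonneg (mul_nonneg h1s.le hy0) (mul_nonneg hs0.le hk0))))
      (mul_nonneg hq0.le (add_nonneg (mul_nonneg h1σ.le (hα01.le.trans (hg1 j hj))) (mul_nonneg hσ0.le (hα11.le.trans (hh j hj)))))
  -- certificate for the SMALL petals
  have hcert' : ∀ j ∈ S \ E, (c0 + τ * (1 - σ) * ((1 - s) * y j + s * k j) + s * (1 - τ) * ((1 - σ) * gc j + σ * h j)) / g ≤
      ∏ i ∈ (Finset.univ : Finset (Fin 6)),
        ((![y j / α00, k j / α01, gc j / α01, h j / α11, ((1 - s) * y j + s * k j) / bY,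
          ((1 - σ) * gc j + σ * h j) / bH] : Fin 6 → ℝ) i) ^ ((![ly, lk, lg, lh, lX, lH] : Fin 6 → ℝ) i) := by
    intro j hj'
    obtain ⟨hj, hjE⟩ := Finset.mem_sdiff.1 hj'
    rw [Fin.prod_univ_six]
    show _ ≤ (y j / α00) ^ ly * (k j / α01) ^ lk * (gc j / α01) ^ lg * (h j / α11) ^ lh *
          (((1 - s) * y j + s * k j) / bY) ^ lX * (((1 - σ) * gc j + σ * h j) / bH) ^ lH
    have hc := hsmall (y j) (k j) (gc j) (h j) (hy j hj) (hyk j hj) (hk1 j hj) (hg1 j hj) (hgk j hj) (hgh j hj) (hh j hj) (hh1 j hj)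
      (hEk j hj hjE) (hEh j hj hjE) (hKc j hj hjE) (hGc j hj hjE) (hHc j hj hjE)
    rw [div_le_iff₀ hgpos]
    calc (c0 + τ * (1 - σ) * ((1 - s) * y j + s * k j) + s * (1 - τ) * ((1 - σ) * gc j + σ * h j))
        ≤ g * (y j / α00) ^ ly * (k j / α01) ^ lk * (gc j / α01) ^ lg * (h j / α11) ^ lh *
          (((1 - s) * y j + s * k j) / bY) ^ lX * (((1 - σ) * gc j + σ * h j) / bH) ^ lH := hc
      _ = _ := by ring
  have hpow : ∀ {b : ℝ}, 0 < b → ∀ {f : κ → ℝ}, ∏ j ∈ S, f j ≤ b ^ (n - 1) → ∏ j ∈ S, f j / b ≤ 1 / b := by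
    intro b hb f hU
    rw [Finset.prod_div_distrib, Finset.prod_const, hcardS, div_le_div_iff₀ (pow_pos hb n) hb]
    have hn1 : 1 ≤ n := by rw [hn]; exact Finset.card_pos.2 hS
    have e : b ^ n = b ^ (n - 1) * b := by rw [← pow_succ]; congr 1; omega
    rw [e]; nlinarith [mul_le_mul_of_nonneg_right hU hb.le]
  have hbudget : ∀ i ∈ (Finset.univ : Finset (Fin 6)),
      ∏ j ∈ S, (![y j / α00, k j / α01, gc j / α01, h j / α11, ((1 - s) * y j + s * k j) / bY,
          ((1 - σ) * gc j + σ * h j) / bH] : Fin 6 → ℝ) i ≤ (![1 / α00, 1 / α01, 1 / α01, 1 / α11, 1 / bY, 1 / bH] : Fin 6 → ℝ) i := by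
    intro i _
    fin_cases i
    · show ∏ j ∈ S, y j / α00 ≤ 1 / α00; exact hpow hα00 hBy
    · show ∏ j ∈ S, k j / α01 ≤ 1 / α01; exact hpow hα01 hBk
    · show ∏ j ∈ S, gc j / α01 ≤ 1 / α01; exact hpow hα01 hBg
    · show ∏ j ∈ S, h j / α11 ≤ 1 / α11; exact hpow hα11 hBh
    · show ∏ j ∈ S, ((1 - s) * y j + s * k j) / bY ≤ 1 / bY; exact hpow hbY0 hBY
    · show ∏ j ∈ S, ((1 - σ) * gc j + σ * h j) / bH ≤ 1 / bH; exact hpow hbH0 hBH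
  have hlam0 : ∀ i ∈ (Finset.univ : Finset (Fin 6)), 0 ≤ (![ly, lk, lg, lh, lX, lH] : Fin 6 → ℝ) i := by
    intro i _; fin_cases i
    · exact hly
    · exact hlk
    · exact hlg
    · exact hlh
    · exact hlX
    · exact hlH
  -- the EXEMPT petals: ∏_E V_j ≤ e^(Σ z) · ∏_i (∏_E u_ji)^λ_i
  have hbig' : ∀ j ∈ E, (c0 + τ * (1 - σ) * ((1 - s) * y j + s * k j) + s * (1 - τ) * ((1 - σ) * gc j + σ * h j)) / g ≤
      Real.exp (z j) * ∏ i ∈ (Finset.univ : Finset (Fin 6)),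
        ((![y j / α00, k j / α01, gc j / α01, h j / α11, ((1 - s) * y j + s * k j) / bY,
          ((1 - σ) * gc j + σ * h j) / bH] : Fin 6 → ℝ) i) ^ ((![ly, lk, lg, lh, lX, lH] : Fin 6 → ℝ) i) := by
    intro j hjE
    have hj : j ∈ S := hES hjE
    rw [Fin.prod_univ_six]
    show _ ≤ Real.exp (z j) * ((y j / α00) ^ ly * (k j / α01) ^ lk * (gc j / α01) ^ lg * (h j / α11) ^ lh *
          (((1 - s) * y j + s * k j) / bY) ^ lX * (((1 - σ) * gc j + σ * h j) / bH) ^ lH)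
    have hc := hbig j hjE
    rw [div_le_iff₀ hgpos]
    calc (c0 + τ * (1 - σ) * ((1 - s) * y j + s * k j) + s * (1 - τ) * ((1 - σ) * gc j + σ * h j))
        ≤ g * Real.exp (z j) * (y j / α00) ^ ly * (k j / α01) ^ lk * (gc j / α01) ^ lg * (h j / α11) ^ lh *
          (((1 - s) * y j + s * k j) / bY) ^ lX * (((1 - σ) * gc j + σ * h j) / bH) ^ lH := hc
      _ = _ := by ring
  set uu : κ → Fin 6 → ℝ := fun j => (![y j / α00, k j / α01, gc j / α01, h j / α11, ((1 - s) * y j + s * k j) / bY,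
      ((1 - σ) * gc j + σ * h j) / bH] : Fin 6 → ℝ) with huu
  set ll : Fin 6 → ℝ := (![ly, lk, lg, lh, lX, lH] : Fin 6 → ℝ) with hll
  set cc : Fin 6 → ℝ := (![1 / α00, 1 / α01, 1 / α01, 1 / α11, 1 / bY, 1 / bH] : Fin 6 → ℝ) with hcc
  set VV : κ → ℝ := fun j => (c0 + τ * (1 - σ) * ((1 - s) * y j + s * k j) + s * (1 - τ) * ((1 - σ) * gc j + σ * h j)) / g with hVV
  have hEprod : ∏ j ∈ E, VV j ≤ Real.exp (∑ j ∈ E, z j) * ∏ i ∈ (Finset.univ : Finset (Fin 6)), (∏ j ∈ E, uu j i) ^ ll i := by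
    have h1 : ∏ j ∈ E, VV j ≤ ∏ j ∈ E, (Real.exp (z j) * ∏ i ∈ (Finset.univ : Finset (Fin 6)), (uu j i) ^ ll i) :=
      Finset.prod_le_prod (fun j hj => hV0 j (hES hj)) (fun j hj => hbig' j hj)
    have h2 : ∏ j ∈ E, (Real.exp (z j) * ∏ i ∈ (Finset.univ : Finset (Fin 6)), (uu j i) ^ ll i) =
        (∏ j ∈ E, Real.exp (z j)) * ∏ j ∈ E, ∏ i ∈ (Finset.univ : Finset (Fin 6)), (uu j i) ^ ll i := Finset.prod_mul_distrib
    have h3 : ∏ j ∈ E, Real.exp (z j) = Real.exp (∑ j ∈ E, z j) := (Real.exp_sum E z).symm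
    have h4 : ∏ j ∈ E, ∏ i ∈ (Finset.univ : Finset (Fin 6)), (uu j i) ^ ll i =
        ∏ i ∈ (Finset.univ : Finset (Fin 6)), (∏ j ∈ E, uu j i) ^ ll i := by
      rw [Finset.prod_comm]
      exact Finset.prod_congr rfl (fun i hi => Real.finsetProd_rpow E (fun j => uu j i)
        (fun j hj => (hupos j (hES hj) i hi).le) (ll i))
    rw [h2, h3, h4] at h1; exact h1
  -- cap: (∏_E V) · ∏_i (cap_i / ∏_E u_ji)^λ_i ≤ e^(Σz) ∏ cap_i^λ_i ≤ T
  have hEupos : ∀ i ∈ (Finset.univ : Finset (Fin 6)), 0 < ∏ j ∈ E, uu j i :=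
    fun i hi => Finset.prod_pos (fun j hj => hupos j (hES hj) i hi)
  have hccpos : ∀ i ∈ (Finset.univ : Finset (Fin 6)), 0 < cc i := by
    intro i _; fin_cases i
    · show 0 < 1 / α00; positivity
    · show 0 < 1 / α01; positivity
    · show 0 < 1 / α01; positivity
    · show 0 < 1 / α11; positivity
    · show 0 < 1 / bY; positivity
    · show 0 < 1 / bH; positivity
  have hcapT : ∏ i ∈ (Finset.univ : Finset (Fin 6)), (cc i) ^ ll i =
      (1 / α00) ^ ly * (1 / α01) ^ lk * (1 / α01) ^ lg * (1 / α11) ^ lh * (1 / bY) ^ lX * (1 / bH) ^ lH := by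
    rw [Fin.prod_univ_six]; rfl
  have hT : (∏ j ∈ E, VV j) * ∏ i ∈ (Finset.univ : Finset (Fin 6)), (cc i / ∏ j ∈ E, uu j i) ^ ll i ≤
      (c0 + τ * (1 - σ) + s * (1 - τ)) / g := by
    have hQ0 : 0 ≤ ∏ i ∈ (Finset.univ : Finset (Fin 6)), (cc i / ∏ j ∈ E, uu j i) ^ ll i :=
      Finset.prod_nonneg (fun i hi => Real.rpow_nonneg (div_nonneg (hccpos i hi).le (hEupos i hi).le) _)
    have h1 : (∏ j ∈ E, VV j) * ∏ i ∈ (Finset.univ : Finset (Fin 6)), (cc i / ∏ j ∈ E, uu j i) ^ ll i ≤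
        (Real.exp (∑ j ∈ E, z j) * ∏ i ∈ (Finset.univ : Finset (Fin 6)), (∏ j ∈ E, uu j i) ^ ll i) *
          ∏ i ∈ (Finset.univ : Finset (Fin 6)), (cc i / ∏ j ∈ E, uu j i) ^ ll i := mul_le_mul_of_nonneg_right hEprod hQ0
    have h2 : (∏ i ∈ (Finset.univ : Finset (Fin 6)), (∏ j ∈ E, uu j i) ^ ll i) *
        ∏ i ∈ (Finset.univ : Finset (Fin 6)), (cc i / ∏ j ∈ E, uu j i) ^ ll i = ∏ i ∈ (Finset.univ : Finset (Fin 6)), (cc i) ^ ll i := by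
      rw [← Finset.prod_mul_distrib]
      apply Finset.prod_congr rfl
      intro i hi
      rw [← Real.mul_rpow (hEupos i hi).le (div_nonneg (hccpos i hi).le (hEupos i hi).le), mul_div_cancel₀ _ (ne_of_gt (hEupos i hi))]
    calc (∏ j ∈ E, VV j) * ∏ i ∈ (Finset.univ : Finset (Fin 6)), (cc i / ∏ j ∈ E, uu j i) ^ ll i
        ≤ Real.exp (∑ j ∈ E, z j) * ((∏ i ∈ (Finset.univ : Finset (Fin 6)), (∏ j ∈ E, uu j i) ^ ll i) *
          ∏ i ∈ (Finset.univ : Finset (Fin 6)), (cc i / ∏ j ∈ E, uu j i) ^ ll i) := by rw [← mul_assoc]; exact h1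
      _ = Real.exp (∑ j ∈ E, z j) * ∏ i ∈ (Finset.univ : Finset (Fin 6)), (cc i) ^ ll i := by rw [h2]
      _ = (∏ i ∈ (Finset.univ : Finset (Fin 6)), (cc i) ^ ll i) * Real.exp (∑ j ∈ E, z j) := mul_comm _ _
      _ ≤ (c0 + τ * (1 - σ) + s * (1 - τ)) / g := by rw [hcapT]; exact hcap
  have main := prod_le_of_power_certificate_exempt (Finset.univ : Finset (Fin 6)) S E hES uu VV cc ll _
    hlam0 hu1 hV0 hcert' hbudget hT
  have e1 : ∏ j ∈ S, VV j = (∏ j ∈ S, (c0 + τ * (1 - σ) * ((1 - s) * y j + s * k j) + s * (1 - τ) * ((1 - σ) * gc j + σ * h j))) / g ^ n := by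
    rw [hVV]; simp only []
    rw [Finset.prod_div_distrib, Finset.prod_const, hcardS]
  rw [e1, div_le_div_iff₀ (pow_pos hgpos n) hgpos] at main
  have hn1 : 1 ≤ n := by rw [hn]; exact Finset.card_pos.2 hS
  have e2 : g ^ n = g ^ (n - 1) * g := by rw [← pow_succ]; congr 1; omega
  rw [e2] at main
  nlinarith [pow_pos hgpos (n - 1), main]

end Summit.CriticalPhenomena.PercolationContinuityZ3.Theorems.SunflowerPartition.SafeCalc.LinkedCurrency
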